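import Literature.MathematicalPhysics.QuantumFieldTheory.Balaban1983to89.B9Thm311FlippedBondLetters
import Literature.MathematicalPhysics.QuantumFieldTheory.Balaban1983to89.B8Prop3MultiLevelTorus

/-!
# `Balaban1983to89.B9Thm311FlippedBondForms` — T. Bałaban, *Propagators for lattice gauge theories in a background field*, Commun. Math. Phys. **99** (1985)
# 389–434 [Balaban1985BackgroundPropagators] (3.10), (3.26) with [Balaban1984PropagatorsII] (2.16), (2.20): THE THREE QUADRATIC FORMS OF `Δ_a(U)` ON THE SINGLE-BOND TEST
# FIELD AT THE CONFIGURATION FLIPPED AT ONE BOND — Wilson Hessian `≤ −d·c_f²HS(E)`, gauge-fixing square `≤ 2c_f²HS(E)`, averaging square `≤ 2b₁L^{−(d+3)}c_f²HS(E)`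
# (file 2∕3 of this seat's «Consequence 2» set; 1∕3 = `B9Thm311FlippedBondLetters`, 3∕3 = `B9Thm311FlippedBondNotPosDef`)

statement-level skeleton of published theorems with citation tags; proofs where landed; nothing here is a claim about the Yang–Mills mass gap

CONTEXT: file 1∕3 `B9Thm311FlippedBondLetters` (print, cell context, honest framing).  Here: the three quadratic-form estimates on the single-bond test field
`A = E·δ_{b₀}` at the configuration flipped at `b₀`; file 3∕3 concludes `¬PosDefTr` and the falsity of the certificate's clause `hΔA` at a member with an uncovered bond.

WHAT IS PROVED HERE (sorry-free; 0 `def`; nothing of [B9]∕[4] asserted — the averaging bookkeeping uses the tree's `B8Prop3MultiLevelTorus.sum_bondAvgIter_single ∕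
bondAvgIter_nonneg` and the member's own (2.16) band `KIdx.hwb : GlobalBand b₀ b₁ c_f w`).
* §4 `zpowers_neg_one_le_unitaryUnits`, ★ `re_trace_jordan_single` (per plaquette `Re tr(F_p\*𝒦F_p) = −∂(p, b₀)²HS(E)`), ★★ `trIP_jordan_single`, ★ `sum_curlK_sq_ge`
  (`Σ_p ∂(p, b₀)² ≥ d·c_f²`: one plaquette `p(x₀; μ₀, κ)` per `κ ≠ μ₀`), ★★★ **`trIP_hessY_single_le`** (`⟨A, Δ(U)A⟩₁ ≤ −d·c_f²·HS(E)`), ★ `trIP_divY_single`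
  (`‖D\*_UA‖₁² = 2c_f²HS(E)`), ★ `trIP_RY_parSymY_le` (`⟨f, R(U)f⟩₁ ≤ ⟨f, f⟩₁` — g7's symmetric idempotent), ★★ **`trIP_gaugeFix_single_le`** (`≤ 2c_f²HS(E)`).
* §5 ★ `qK_eq_bondAvgIter` (`Q(ι, b₀) = (Q_{n(ι)}δ_{b₀})(c(ι))`), `qK_nonneg`, `xL_bounds`, ★★ `sum_qK_le` (`Σ_{ι∈𝔅} Q(ι, b₀) ≤ 2L^{−(d+1)}`: column mass per level, no
  level-0 index bond, geometric sum), ★ `qK_le`, ★★ `w_mul_qK_sq_le` (`w(ι)Q(ι, b₀)² ≤ b₁c_f²L⁻²Q(ι, b₀)`), `trIP_self_eq_sum`, ★★★ **`trIP_QY_single_le`**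
  (`⟨Q(U)A, Q(U)A⟩_w ≤ 2b₁·L^{−(d+1)}·L⁻²·c_f²·HS(E)`).
MODEL ∕ HONEST SCOPE.  As file 1∕3 (def-Y letters, `M_N(ℂ)`, `trIP`), plus the member's weights `i.w` and band `[b₀, b₁]` (`GlobalBand`), `L = ℓ + 1 ≥ 5`;
finite lattice algebra + the (2.16) band; count-neutral; NOT a node discharge; nothing continuum ∕ OS ∕ mass gap ∕ Clay.  Cell `pub-ymgap` (D-0062), N06 [B9], seat
`pub-ymgap-dag-n06-j` g11, 2026-08-27; dag-lead g10 INTENT-4 DEDUP.  NEW file importing file 1∕3 and `B8Prop3MultiLevelTorus`; nothing landed is modified.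
-/

noncomputable section

namespace Literature.MathematicalPhysics.QuantumFieldTheory.Balaban1983to89.B9Thm311FlippedBondForms

open Literature.MathematicalPhysics.QuantumFieldTheory.Balaban1983to89
open B9Thm311ReadingCoords B9Thm311AdjointAtLetters B9Thm311DeltaPrimeSymm B9Thm311DeltaPrimePos B9Thm311AdjointPairs B9Thm311Curv2Symm
  B9Thm311ProjectionR B9Ineq349SiteAdjoint B9Ineq369CurvatureSmallAtLettersY B9Thm311PosOfPrincipalAtLettersY B9Eq335PlaquetteAtLettersY
  B9Eq335CoverageAtLettersY Node00
open B6KLevelCensusIndexV1 B9BackgroundsKLevelV1 B6GlobalChartV1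
open scoped Matrix
open B9Thm311FlippedBondLetters

/-! ## §4 The Hessian and the gauge-fixing square on the single-bond test field at the flipped configuration -/

section Forms

open scoped Matrix.Norms.L2Operator

variable {d ℓ : ℕ} {hd : 1 ≤ d + 1} {hL : Odd (ℓ + 1) ∧ 1 < ℓ + 1} {b₀ b₁ : ℝ} {N : ℕ}
variable (i : KIdx d ℓ hd hL b₀ b₁)

/-- the elements of the subgroup generated by `−1` are `±1` (file 1∕3's private helper, re-proved). [folklore] -/
private theorem sign_of_mem' {V : (Matrix (Fin N) (Fin N) ℂ)ˣ} (hV : V ∈ Subgroup.zpowers (-1 : (Matrix (Fin N) (Fin N) ℂ)ˣ)) : V = 1 ∨ V = -1 := by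
  obtain ⟨k, rfl⟩ := Subgroup.mem_zpowers_iff.1 hV
  rcases Int.eq_nat_or_neg k with ⟨n, rfl | rfl⟩
  · rw [zpow_natCast]; exact neg_one_pow_eq_or _ n
  · rw [zpow_neg, zpow_natCast]
    rcases neg_one_pow_eq_or ((Matrix (Fin N) (Fin N) ℂ)ˣ) n with h | h <;> rw [h]
    · exact Or.inl inv_one
    · exact Or.inr (by rw [inv_neg, inv_one])

/-- `−1 ≠ 1` among the units of `M_N(ℂ)`, `N ≥ 1`. [folklore] -/
private theorem neg_one_ne_one [Nonempty (Fin N)] : (-1 : (Matrix (Fin N) (Fin N) ℂ)ˣ) ≠ 1 := by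
  intro h
  have h1 : ((-1 : (Matrix (Fin N) (Fin N) ℂ)ˣ) : Matrix (Fin N) (Fin N) ℂ) = 1 := by rw [h, Units.val_one]
  rw [Units.val_neg, Units.val_one] at h1
  obtain ⟨a⟩ := ‹Nonempty (Fin N)›
  have h2 := congrFun (congrFun h1 a) a
  simp only [Matrix.neg_apply, Matrix.one_apply_eq] at h2
  norm_num at h2

/-- `{±1} ≤ U(N)`. [cite: Balaban1985BackgroundPropagators, (3.35) p.396 (U ∈ G ⊂ U(N)), bookkeeping] -/
theorem zpowers_neg_one_le_unitaryUnits :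
    Subgroup.zpowers (-1 : (Matrix (Fin N) (Fin N) ℂ)ˣ) ≤ B7Prop2Explicit.unitaryUnits (Matrix (Fin N) (Fin N) ℂ) := by
  rw [Subgroup.zpowers_le]
  show ((-1 : (Matrix (Fin N) (Fin N) ℂ)ˣ) : Matrix (Fin N) (Fin N) ℂ) ∈ unitary (Matrix (Fin N) (Fin N) ℂ)
  rw [Units.val_neg, Units.val_one]
  exact Unitary.mem_iff.2 ⟨by rw [star_neg, star_one, neg_mul_neg, one_mul], by rw [star_neg, star_one, neg_mul_neg, one_mul]⟩

variable {U : CfgY (Matrix (Fin N) (Fin N) ℂ) i} {μ₀ : Fin (PV d ℓ i.m i.K hd hL).d} {x₀ : Site (PV d ℓ i.m i.K hd hL) 0}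
  (hb₀ : U μ₀ x₀ = -1) (hoff : ∀ μ x, ¬ (μ = μ₀ ∧ x = x₀) → U μ x = 1)
include hb₀ hoff

/-- ★ per plaquette, on the test field `A = E·δ_{b₀}`: `Re tr((D_UA)(p)\* · 𝒦_U(D_UA)(p)) = −∂(p, b₀)²·HS(E)` — the frustrated plaquettes (`U(∂p) = −1`,
Jordan insertion `−id`) are exactly those with `∂(p, b₀) ≠ 0`. [cite: Balaban1985BackgroundPropagators, (3.10) p.392] -/
theorem re_trace_jordan_single [Nonempty (Fin N)] (E : Matrix (Fin N) (Fin N) ℂ) (p : PlaqY i) :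
    (Matrix.trace ((curlY i U (Pi.single ⟨x₀, μ₀⟩ E) p)ᴴ * jordanY i U (curlY i U (Pi.single ⟨x₀, μ₀⟩ E)) p)).re =
      -((curlK i p ⟨x₀, μ₀⟩) ^ 2 * ∑ a, ∑ b, ‖E a b‖ ^ 2) := by
  have hU := mem_of_flipped i hb₀ hoff
  rw [jordanY_apply, reHolY_eq i hU, curlY_single i hU]
  rcases sign_of_mem' (holY_mem i hU p) with h1 | h1
  · -- unfrustrated plaquette: then `∂(p, b₀) = 0`
    have hc : curlK i p ⟨x₀, μ₀⟩ = 0 := by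
      by_contra hc
      exact neg_one_ne_one ((holY_eq_neg_one_of_curlK_ne_zero i hb₀ hoff p hc).symm.trans h1)
    simp [hc]
  · rw [h1, Units.val_neg, Units.val_one, mul_neg_one, neg_one_mul, ← two_smul ℂ, smul_smul, show (1 / 2 : ℂ) * 2 = 1 by norm_num, one_smul,
      Matrix.mul_neg, Matrix.trace_neg, Complex.neg_re, ← hs_eq_re_trace, hs_real_smul]

/-- ★★ on the test field, `⟨D_UA, 𝒦_UD_UA⟩₁ = −HS(E)·Σ_p ∂(p, b₀)²`. [cite: Balaban1985BackgroundPropagators, (3.10) p.392] -/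
theorem trIP_jordan_single [Nonempty (Fin N)] (E : Matrix (Fin N) (Fin N) ℂ) :
    trIP (fun _ => (1 : ℝ)) (curlY i U (Pi.single ⟨x₀, μ₀⟩ E)) (jordanY i U (curlY i U (Pi.single ⟨x₀, μ₀⟩ E))) =
      -((∑ p : PlaqY i, (curlK i p ⟨x₀, μ₀⟩) ^ 2) * ∑ a, ∑ b, ‖E a b‖ ^ 2) := by
  rw [trIP_one_eq, Complex.re_sum, Finset.sum_congr rfl fun p _ => re_trace_jordan_single i hb₀ hoff E p, Finset.sum_neg_distrib, Finset.sum_mul]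

omit hb₀ hoff in
/-- the plaquette `p(x₀; μ₀, κ)` spanned by `b₀` and a second direction `κ ≠ μ₀`. [cite: Balaban1985BackgroundPropagators, (3.1) p.390, bookkeeping] -/
private theorem exists_plaq (κ : Fin (PV d ℓ i.m i.K hd hL).d) (hκ : κ ≠ μ₀) :
    ∃ p : PlaqY i, p.src = x₀ ∧ ((p.μ = μ₀ ∧ p.ν = κ) ∨ (p.μ = κ ∧ p.ν = μ₀)) := by
  rcases lt_or_gt_of_ne hκ with h | h
  · exact ⟨⟨x₀, κ, μ₀, h⟩, rfl, Or.inr ⟨rfl, rfl⟩⟩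
  · exact ⟨⟨x₀, μ₀, κ, h⟩, rfl, Or.inl ⟨rfl, rfl⟩⟩

omit hb₀ hoff in
/-- on such a plaquette `∂(p, b₀)² = c_f²`. [cite: Balaban1985BackgroundPropagators, (3.4) p.391, bookkeeping] -/
private theorem curlK_sq_of_plaq {p : PlaqY i} (hsrc : p.src = x₀) (hdir : (p.μ = μ₀ ∧ p.ν ≠ μ₀) ∨ (p.ν = μ₀ ∧ p.μ ≠ μ₀)) :
    (curlK i p ⟨x₀, μ₀⟩) ^ 2 = i.cf ^ 2 := by
  have hs1 : p.src.shift p.ν ≠ p.src := shift_ne_self i p.src p.ν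
  have hs2 : p.src.shift p.μ ≠ p.src := shift_ne_self i p.src p.μ
  rw [curlK_eq_of_edge]
  subst hsrc
  rcases hdir with ⟨hμ, hν⟩ | ⟨hν, hμ⟩
  · subst hμ
    rw [if_pos rfl, if_neg, if_neg, if_neg] <;> simp [PBond.mk.injEq, hν, hs1]
  · subst hν
    rw [if_neg, if_neg, if_neg, if_pos rfl] <;> simp [PBond.mk.injEq, hμ, hs2]

omit hb₀ hoff in
/-- ★ **AT LEAST `d` PLAQUETTES CONTAIN `b₀`** (one per second direction, all based at `x₀`): `Σ_p ∂(p, b₀)² ≥ d·c_f²`.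
[cite: Balaban1985BackgroundPropagators, (3.69) p.404 («plaquettes containing the bond b»)] -/
theorem sum_curlK_sq_ge : (d : ℝ) * i.cf ^ 2 ≤ ∑ p : PlaqY i, (curlK i p ⟨x₀, μ₀⟩) ^ 2 := by
  classical
  -- choose, for each `κ ≠ μ₀`, the plaquette `p(x₀; μ₀, κ)`
  choose f hf using fun κ : {κ : Fin (PV d ℓ i.m i.K hd hL).d // κ ≠ μ₀} => exists_plaq i κ.1 κ.2
  have hinj : Function.Injective f := by
    intro κ κ' h
    apply Subtype.ext
    have h1 := (hf κ).2
    have h2 := (hf κ').2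
    rw [h] at h1
    rcases h1 with ⟨a1, a2⟩ | ⟨a1, a2⟩ <;> rcases h2 with ⟨c1, c2⟩ | ⟨c1, c2⟩
    · exact a2.symm.trans c2
    · exact absurd (a1.symm.trans c1).symm κ'.2
    · exact absurd (a1.symm.trans c1) κ.2
    · exact a1.symm.trans c1
  have hval : ∀ κ, (curlK i (f κ) ⟨x₀, μ₀⟩) ^ 2 = i.cf ^ 2 := by
    intro κ
    refine curlK_sq_of_plaq i (hf κ).1 ?_
    rcases (hf κ).2 with ⟨a1, a2⟩ | ⟨a1, a2⟩
    · exact Or.inl ⟨a1, a2 ▸ κ.2⟩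
    · exact Or.inr ⟨a2, a1 ▸ κ.2⟩
  have hcard : Fintype.card {κ : Fin (PV d ℓ i.m i.K hd hL).d // κ ≠ μ₀} = d := by
    rw [Fintype.card_subtype_compl, Fintype.card_fin, Fintype.card_subtype_eq]
    show d + 1 - 1 = d
    omega
  calc (d : ℝ) * i.cf ^ 2 = ∑ κ : {κ : Fin (PV d ℓ i.m i.K hd hL).d // κ ≠ μ₀}, (curlK i (f κ) ⟨x₀, μ₀⟩) ^ 2 := by
        rw [Finset.sum_congr rfl fun κ _ => hval κ, Finset.sum_const, Finset.card_univ, hcard, nsmul_eq_mul]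
    _ = ∑ p ∈ Finset.univ.image f, (curlK i p ⟨x₀, μ₀⟩) ^ 2 :=
        (Finset.sum_image (s := Finset.univ) (f := fun p => (curlK i p ⟨x₀, μ₀⟩) ^ 2) fun a _ b _ h => hinj h).symm
    _ ≤ ∑ p : PlaqY i, (curlK i p ⟨x₀, μ₀⟩) ^ 2 := Finset.sum_le_sum_of_subset_of_nonneg (Finset.subset_univ _) fun _ _ _ => sq_nonneg _

/-- ★★★ **THE WILSON HESSIAN IS NEGATIVE ON THE TEST FIELD**: `⟨A, Δ(U)A⟩₁ ≤ −d·c_f²·HS(E)` for `A = E·δ_{b₀}` at the configuration flipped at `b₀`.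
[cite: Balaban1985BackgroundPropagators, (3.10) p.392] -/
theorem trIP_hessY_single_le [Nonempty (Fin N)] (E : Matrix (Fin N) (Fin N) ℂ) :
    trIP (fun _ => (1 : ℝ)) (Pi.single ⟨x₀, μ₀⟩ E) (hessY i U (Pi.single ⟨x₀, μ₀⟩ E)) ≤ -((d : ℝ) * i.cf ^ 2 * ∑ a, ∑ b, ‖E a b‖ ^ 2) := by
  have hU := mem_of_flipped i hb₀ hoff
  rw [trIP_hessY_eq i (mem_unitary_of_mem i hU), trIP_curv2Y_eq_zero i hU, add_zero, trIP_jordan_single i hb₀ hoff E]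
  have hE := hs_nonneg E
  nlinarith [sum_curlK_sq_ge i (μ₀ := μ₀) (x₀ := x₀), hE]

/-- ★ the covariant divergence of the test field has `‖D*_UA‖₁² = 2c_f²·HS(E)` (two endpoints, entries `±c_f`).
[cite: Balaban1985BackgroundPropagators, (3.8) p.392] -/
theorem trIP_divY_single (E : Matrix (Fin N) (Fin N) ℂ) :
    trIP (fun _ => (1 : ℝ)) (divY i U (Pi.single ⟨x₀, μ₀⟩ E)) (divY i U (Pi.single ⟨x₀, μ₀⟩ E)) = 2 * i.cf ^ 2 * ∑ a, ∑ b, ‖E a b‖ ^ 2 := by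
  classical
  have hU := mem_of_flipped i hb₀ hoff
  rw [trIP_one_self_eq]
  simp_rw [divY_single i hU, hs_real_smul]
  rw [← Finset.sum_mul]
  congr 1
  -- `Σ_z ∂*(z, b₀)² = 2c_f²`
  have hentry : ∀ z : SiteY i, divK i z ⟨x₀, μ₀⟩ =
      i.cf * ((if (x₀.shift μ₀) = (boxEquiv i.hN).symm z then 1 else 0) - (if x₀ = (boxEquiv i.hN).symm z then 1 else 0)) := by
    intro z
    rw [divK_eq_transpose, Matrix.transpose_apply]
    exact B6AgreeLapV1Chart.toMatrix'_dE _ _ _ _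
  simp_rw [hentry]
  rw [show (∑ z : SiteY i, (i.cf * ((if x₀.shift μ₀ = (boxEquiv i.hN).symm z then (1 : ℝ) else 0) - (if x₀ = (boxEquiv i.hN).symm z then 1 else 0))) ^ 2)
      = ∑ x : Site (PV d ℓ i.m i.K hd hL) 0, (i.cf * ((if x₀.shift μ₀ = x then (1 : ℝ) else 0) - (if x₀ = x then 1 else 0))) ^ 2 from
      Equiv.sum_comp (boxEquiv i.hN).symm (fun x => (i.cf * ((if x₀.shift μ₀ = x then (1 : ℝ) else 0) - (if x₀ = x then 1 else 0))) ^ 2)]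
  have hne : x₀.shift μ₀ ≠ x₀ := shift_ne_self i x₀ μ₀
  have hpt : ∀ x : Site (PV d ℓ i.m i.K hd hL) 0,
      (i.cf * ((if x₀.shift μ₀ = x then (1 : ℝ) else 0) - (if x₀ = x then 1 else 0))) ^ 2 =
        i.cf ^ 2 * (if x₀.shift μ₀ = x then 1 else 0) + i.cf ^ 2 * (if x₀ = x then 1 else 0) := by
    intro x
    by_cases h1 : x₀.shift μ₀ = x
    · have h2 : ¬ x₀ = x := fun h2 => hne (h1.trans h2.symm)
      rw [if_pos h1, if_neg h2]; ring
    · by_cases h2 : x₀ = x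
      · rw [if_neg h1, if_pos h2]; ring
      · rw [if_neg h1, if_neg h2]; ring
  simp_rw [hpt]
  rw [Finset.sum_add_distrib, ← Finset.mul_sum, ← Finset.mul_sum, Finset.sum_ite_eq, Finset.sum_ite_eq, if_pos (Finset.mem_univ _),
    if_pos (Finset.mem_univ _)]
  ring

omit hb₀ hoff in
/-- an orthogonal projection is bounded by the identity: `⟨f, R(U)f⟩₁ ≤ ⟨f, f⟩₁` for def-Y's (3.25) `R(U)` at `G`-valued data, `G ≤ U(N)`.
[cite: Balaban1985BackgroundPropagators, (3.20)–(3.25) pp.394–395 («orthogonal projection»)] -/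
theorem trIP_RY_parSymY_le {G : Subgroup (Matrix (Fin N) (Fin N) ℂ)ˣ} (hG : G ≤ B7Prop2Explicit.unitaryUnits (Matrix (Fin N) (Fin N) ℂ))
    (hUG : ∀ μ x, U μ x ∈ G) (f : SiteY i → Matrix (Fin N) (Fin N) ℂ) :
    trIP (fun _ => (1 : ℝ)) f (RY i (parSymY i) (GpY i (parSymY i)) U f) ≤ trIP (fun _ => (1 : ℝ)) f f := by
  set Rf := RY i (parSymY i) (GpY i (parSymY i)) U f with hRf
  have h1 : trIP (fun _ => (1 : ℝ)) f Rf = trIP (fun _ => (1 : ℝ)) Rf Rf := trIP_RY_parSymY_self i hG hUG f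
  have h2 : 0 ≤ trIP (fun _ => (1 : ℝ)) (f + -Rf) (f + -Rf) := trIP_self_nonneg _ (fun _ => one_pos) _
  rw [trIP_add_right, trIP_comm _ (f + -Rf) f, trIP_comm _ (f + -Rf) (-Rf), trIP_add_right, trIP_add_right, B9Thm311DeltaAFrustratedWitness.trIP_neg_right,
    B9Thm311DeltaAFrustratedWitness.trIP_neg_right, trIP_comm _ (-Rf) f, B9Thm311DeltaAFrustratedWitness.trIP_neg_right, trIP_comm _ (-Rf) Rf,
    B9Thm311DeltaAFrustratedWitness.trIP_neg_right] at h2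
  linarith

/-- ★★ **THE GAUGE-FIXING SQUARE ON THE TEST FIELD**: `⟨D*_UA, R(U)D*_UA⟩₁ ≤ 2c_f²·HS(E)`. [cite: Balaban1985BackgroundPropagators, (3.26) p.395, (3.8) p.392] -/
theorem trIP_gaugeFix_single_le (E : Matrix (Fin N) (Fin N) ℂ) :
    trIP (fun _ => (1 : ℝ)) (divY i U (Pi.single ⟨x₀, μ₀⟩ E)) (RY i (parSymY i) (GpY i (parSymY i)) U (divY i U (Pi.single ⟨x₀, μ₀⟩ E)))
      ≤ 2 * i.cf ^ 2 * ∑ a, ∑ b, ‖E a b‖ ^ 2 := by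
  rw [← trIP_divY_single i hb₀ hoff E]
  exact trIP_RY_parSymY_le i zpowers_neg_one_le_unitaryUnits (mem_of_flipped i hb₀ hoff) _

end Forms

/-! ## §5 The averaging square on the single-bond test field: `⟨Q(U)A, Q(U)A⟩_w ≤ 2b₁L^{−(d+3)}·c_f²·HS(E)` from the (2.16) band -/

section Averaging

open scoped Matrix.Norms.L2Operator

variable {d ℓ : ℕ} {hd : 1 ≤ d + 1} {hL : Odd (ℓ + 1) ∧ 1 < ℓ + 1} {b₀ b₁ : ℝ} {N : ℕ}
variable (i : KIdx d ℓ hd hL b₀ b₁)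

/-- the `Q`-kernel entry IS the iterated block average of a unit bond function: `Q(ι, b₀) = (Q_{n(ι)}δ_{b₀})(c(ι))`.
[cite: Balaban1984PropagatorsII, (2.20) p.226; Balaban1984PropagatorsI, (1.18) p.20] -/
theorem qK_eq_bondAvgIter (ι : IBondY i) (b₀ : FBondY i) :
    qK i ι b₀ = LatticeFieldCalculus.bondAvgIter (ι.1.1 : ℕ) (Pi.single b₀ (1 : ℝ)) ι.1.2 := by
  rw [qK, LinearMap.toMatrix'_apply, B6Ineq2133TwoScaleV1.onFun_apply, B6SectAOperatorsV1.QE_apply, WithLp.ofLp_toLp]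

/-- `0 ≤ Q(ι, b₀)`. [cite: Balaban1984PropagatorsI, (1.18) p.20 (averaging with positive weights)] -/
theorem qK_nonneg (ι : IBondY i) (b₀ : FBondY i) : 0 ≤ qK i ι b₀ := by
  rw [qK_eq_bondAvgIter]
  exact B8Prop3MultiLevelTorus.bondAvgIter_nonneg _ (fun b => by by_cases h : b = b₀ <;> simp [h]) _

/-- the weight of the averaging mode `x = L^{−(d+1)}` (one block step). [cite: Balaban1984PropagatorsI, (1.11) p.19, bookkeeping] -/
theorem xL_bounds : 0 ≤ (((((PV d ℓ i.m i.K hd hL).L : ℕ) : ℝ) ^ (PV d ℓ i.m i.K hd hL).d)⁻¹) ∧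
    (((((PV d ℓ i.m i.K hd hL).L : ℕ) : ℝ) ^ (PV d ℓ i.m i.K hd hL).d)⁻¹) ≤ 1 / 2 := by
  have hL5 : (5 : ℝ) ≤ (((PV d ℓ i.m i.K hd hL).L : ℕ) : ℝ) := by
    show (5 : ℝ) ≤ ((ℓ + 1 : ℕ) : ℝ)
    have := i.hℓ; exact_mod_cast (by omega)
  have hpow : (2 : ℝ) ≤ (((PV d ℓ i.m i.K hd hL).L : ℕ) : ℝ) ^ (PV d ℓ i.m i.K hd hL).d := by
    show (2 : ℝ) ≤ (((PV d ℓ i.m i.K hd hL).L : ℕ) : ℝ) ^ (d + 1)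
    calc (2 : ℝ) ≤ 5 ^ 1 := by norm_num
      _ ≤ (((PV d ℓ i.m i.K hd hL).L : ℕ) : ℝ) ^ 1 := by gcongr
      _ ≤ (((PV d ℓ i.m i.K hd hL).L : ℕ) : ℝ) ^ (d + 1) := pow_le_pow_right₀ (by linarith) (by omega)
  refine ⟨by positivity, ?_⟩
  rw [one_div]
  exact inv_anti₀ (by norm_num) hpow

/-- ★ **THE COLUMN MASS OF THE MULTI-LEVEL `Q`-KERNEL AT A FINE BOND**: `Σ_{ι ∈ 𝔅} Q(ι, b₀) ≤ 2L^{−(d+1)}` — every level `n` contributes at most the full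
`Q_n`-column mass `L^{−n(d+1)}` (`sum_bondAvgIter_single`), and there is no index bond at level `0` (`not_lamBond_zero`).
[cite: Balaban1984PropagatorsII, (2.20) p.226, (2.3) p.224; Balaban1984PropagatorsI, (1.18) p.20] -/
theorem sum_qK_le (b₀ : FBondY i) :
    ∑ ι : IBondY i, qK i ι b₀ ≤ 2 * (((((PV d ℓ i.m i.K hd hL).L : ℕ) : ℝ) ^ (PV d ℓ i.m i.K hd hL).d)⁻¹) := by
  classical
  set x : ℝ := (((((PV d ℓ i.m i.K hd hL).L : ℕ) : ℝ) ^ (PV d ℓ i.m i.K hd hL).d)⁻¹) with hx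
  obtain ⟨hx0, hx1⟩ := xL_bounds i
  -- pass from the index set `𝔅` to all pairs `(n, c)` with `1 ≤ n`
  let g : (Σ j : Fin ((domT i.hN i.D i.hk).k + 1), PBond (PV d ℓ i.m i.K hd hL) (j : ℕ)) → ℝ :=
    fun q => if 1 ≤ (q.1 : ℕ) then LatticeFieldCalculus.bondAvgIter (q.1 : ℕ) (Pi.single b₀ (1 : ℝ)) q.2 else 0
  have hg0 : ∀ q, 0 ≤ g q := fun q => by
    simp only [g]; split_ifs
    · exact B8Prop3MultiLevelTorus.bondAvgIter_nonneg _ (fun b => by by_cases h : b = b₀ <;> simp [h]) _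
    · exact le_rfl
  have h1 : ∑ ι : IBondY i, qK i ι b₀ = ∑ ι : IBondY i, g ι.1 := by
    refine Finset.sum_congr rfl fun ι _ => ?_
    have hn : 1 ≤ (ι.1.1 : ℕ) := by
      by_contra h0
      have h0' : (ι.1.1 : ℕ) = 0 := by omega
      have := ι.2
      obtain ⟨⟨j, c⟩, hq⟩ := ι
      simp only at h0'
      have hj : j = ⟨0, Nat.succ_pos _⟩ := Fin.ext h0'
      subst hj
      exact B9Thm311DeltaAFrustratedWitness.not_lamBond_zero i c hq
    simp only [g, if_pos hn, qK_eq_bondAvgIter]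
  have h2 : ∑ ι : IBondY i, g ι.1 ≤ ∑ q : (Σ j : Fin ((domT i.hN i.D i.hk).k + 1), PBond (PV d ℓ i.m i.K hd hL) (j : ℕ)), g q := by
    rw [← Finset.sum_subtype (Finset.univ.filter fun q => (domT i.hN i.D i.hk).LamBond q.1 q.2) (by simp) g]
    exact Finset.sum_le_sum_of_subset_of_nonneg (Finset.filter_subset _ _) fun q _ _ => hg0 q
  have h3 : ∑ q : (Σ j : Fin ((domT i.hN i.D i.hk).k + 1), PBond (PV d ℓ i.m i.K hd hL) (j : ℕ)), g q =
      ∑ j : Fin ((domT i.hN i.D i.hk).k + 1), if 1 ≤ (j : ℕ) then x ^ (j : ℕ) else 0 := by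
    rw [← Finset.univ_sigma_univ, Finset.sum_sigma]
    refine Finset.sum_congr rfl fun j _ => ?_
    by_cases hj : 1 ≤ (j : ℕ)
    · simp only [g, if_pos hj]
      rw [hx]
      exact B8Prop3MultiLevelTorus.sum_bondAvgIter_single (P := PV d ℓ i.m i.K hd hL) (le_trans (Nat.le_of_lt_succ j.2) i.hk) b₀
    · simp only [g, if_neg hj, Finset.sum_const_zero]
  have h4 : ∑ j : Fin ((domT i.hN i.D i.hk).k + 1), (if 1 ≤ (j : ℕ) then x ^ (j : ℕ) else 0) ≤ x / (1 - x) := by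
    rw [Fin.sum_univ_eq_sum_range (fun j => if 1 ≤ j then x ^ j else 0), ← Finset.sum_filter]
    have hsub : (Finset.range ((domT i.hN i.D i.hk).k + 1)).filter (fun j => 1 ≤ j) = Finset.Ico 1 ((domT i.hN i.D i.hk).k + 1) := by
      ext j; simp [Finset.mem_Ico]; omega
    rw [hsub]
    have := geom_sum_Ico_le_of_lt_one hx0 (by linarith) (m := 1) (n := (domT i.hN i.D i.hk).k + 1)
    rwa [pow_one] at this
  have h5 : x / (1 - x) ≤ 2 * x := by
    rw [div_le_iff₀ (by linarith)]
    nlinarith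
  calc ∑ ι : IBondY i, qK i ι b₀ = ∑ ι : IBondY i, g ι.1 := h1
    _ ≤ _ := h2
    _ = _ := h3
    _ ≤ x / (1 - x) := h4
    _ ≤ 2 * x := h5

/-- ★ a kernel entry is at most its column mass at its level, hence `Q(ι, b₀) ≤ (L^{n(ι)})^{−(d+1)}`.
[cite: Balaban1984PropagatorsI, (1.18) p.20] -/
theorem qK_le (ι : IBondY i) (b₀ : FBondY i) :
    qK i ι b₀ ≤ ((((((PV d ℓ i.m i.K hd hL).L : ℕ) : ℝ) ^ (PV d ℓ i.m i.K hd hL).d)⁻¹) ^ (ι.1.1 : ℕ)) := by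
  classical
  rw [qK_eq_bondAvgIter, ← B8Prop3MultiLevelTorus.sum_bondAvgIter_single (P := PV d ℓ i.m i.K hd hL) (le_trans (Nat.le_of_lt_succ ι.1.1.2) i.hk) b₀]
  exact Finset.single_le_sum (fun c _ => B8Prop3MultiLevelTorus.bondAvgIter_nonneg _ (fun b => by by_cases h : b = b₀ <;> simp [h]) c)
    (Finset.mem_univ _)

/-- ★ **THE (2.16) BAND AGAINST THE KERNEL**: at an index bond of level `n ≥ 1`, `w(ι)·Q(ι, b₀)² ≤ b₁·c_f²·L⁻²·Q(ι, b₀)` — from `w(ι) ≤ b₁(Lⁿ)^{d+1}(c_f/Lⁿ)²`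
(`GlobalBand`) and `Q(ι, b₀) ≤ (Lⁿ)^{−(d+1)}`. [cite: Balaban1984PropagatorsII, (2.16) p.225, (2.20) p.226] -/
theorem w_mul_qK_sq_le (hb₁ : 0 ≤ b₁) (ι : IBondY i) (b₀ : FBondY i) :
    i.w ι * (qK i ι b₀) ^ 2 ≤ b₁ * i.cf ^ 2 * ((((ℓ + 1 : ℕ) : ℝ)) ^ 2)⁻¹ * qK i ι b₀ := by
  have hn : 1 ≤ (ι.1.1 : ℕ) := by
    by_contra h0
    have h0' : (ι.1.1 : ℕ) = 0 := by omega
    obtain ⟨⟨j, c⟩, hq⟩ := ι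
    simp only at h0'
    have hj : j = ⟨0, Nat.succ_pos _⟩ := Fin.ext h0'
    subst hj
    exact B9Thm311DeltaAFrustratedWitness.not_lamBond_zero i c hq
  set Ln : ℝ := (((ℓ + 1 : ℕ) : ℝ)) ^ (ι.1.1 : ℕ) with hLn
  have hL1 : (1 : ℝ) ≤ ((ℓ + 1 : ℕ) : ℝ) := by exact_mod_cast Nat.succ_le_succ (Nat.zero_le ℓ)
  have hLn1 : (1 : ℝ) ≤ Ln := one_le_pow₀ hL1
  have hLnpos : 0 < Ln := lt_of_lt_of_le one_pos hLn1
  have hcf : i.cf ≠ 0 := i.hcf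
  -- the band: `w ι ≤ b₁ · Ln^{d+1} · (cf/Ln)²`
  have hband := (i.hwb ι).2
  have hw : i.w ι ≤ b₁ * Ln ^ (d + 1) * (i.cf / Ln) ^ 2 := by
    have hpos : 0 < (i.cf / Ln) ^ 2 := by positivity
    rw [div_le_iff₀ hpos] at hband
    exact hband
  -- the kernel: `q ≤ (L^{d+1})^{-n} = (Ln^{d+1})⁻¹`
  have hq := qK_le i ι b₀
  have hq' : qK i ι b₀ ≤ (Ln ^ (d + 1))⁻¹ := by
    rw [hLn]
    convert hq using 1
    show (((((ℓ + 1 : ℕ) : ℝ)) ^ (ι.1.1 : ℕ)) ^ (d + 1))⁻¹ = (((((ℓ + 1 : ℕ) : ℝ)) ^ (d + 1))⁻¹) ^ (ι.1.1 : ℕ)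
    rw [inv_pow, ← pow_mul, ← pow_mul, mul_comm]
  have hq0 := qK_nonneg i ι b₀
  have hw0 : 0 ≤ i.w ι := (i.hw ι).le
  -- `L⁻² ≥ Ln⁻²` since `n ≥ 1`
  have hL2 : (Ln ^ 2)⁻¹ ≤ ((((ℓ + 1 : ℕ) : ℝ)) ^ 2)⁻¹ := by
    apply inv_anti₀ (by positivity)
    have : (((ℓ + 1 : ℕ) : ℝ)) ^ 1 ≤ Ln := by rw [hLn]; exact pow_le_pow_right₀ hL1 hn
    rw [pow_one] at this
    gcongr
  calc i.w ι * (qK i ι b₀) ^ 2 ≤ (b₁ * Ln ^ (d + 1) * (i.cf / Ln) ^ 2) * (qK i ι b₀ * (Ln ^ (d + 1))⁻¹) := by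
        rw [sq]
        exact mul_le_mul hw (mul_le_mul_of_nonneg_left hq' hq0) (mul_nonneg hq0 hq0) (by positivity)
    _ = b₁ * i.cf ^ 2 * (Ln ^ 2)⁻¹ * qK i ι b₀ := by field_simp
    _ ≤ b₁ * i.cf ^ 2 * ((((ℓ + 1 : ℕ) : ℝ)) ^ 2)⁻¹ * qK i ι b₀ := by gcongr

/-- the `w`-weighted trace norm is the weighted sum of the fibre Hilbert–Schmidt sums. [cite: Balaban1984PropagatorsII, (2.69) p.235 (the weighted pairing), bookkeeping] -/
theorem trIP_self_eq_sum {S : Type} [Fintype S] (w : S → ℝ) (Φ : S → Matrix (Fin N) (Fin N) ℂ) :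
    trIP w Φ Φ = ∑ s, w s * ∑ a, ∑ b, ‖Φ s a b‖ ^ 2 := by
  rw [trIP_eq_re_trace]
  exact Finset.sum_congr rfl fun s _ => by rw [hs_eq_re_trace]

variable {U : CfgY (Matrix (Fin N) (Fin N) ℂ) i} (hU : ∀ μ x, U μ x ∈ Subgroup.zpowers (-1 : (Matrix (Fin N) (Fin N) ℂ)ˣ))
include hU

/-- ★★ **THE AVERAGING SQUARE ON THE TEST FIELD IS NEGLIGIBLE**: `⟨Q(U)A, Q(U)A⟩_w ≤ 2b₁L^{−(d+1)}L⁻²·c_f²·HS(E) = 2b₁L^{−(d+3)}c_f²HS(E)` for `A = E·δ_{b₀}`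
at any `{±1}`-valued configuration (the multi-level averaging charges a fine bond with total mass `≤ 2L^{−(d+1)}`, each level-`n` mode weighing `≤ b₁c_f²L^{n(d−1)}`).
[cite: Balaban1984PropagatorsII, (2.16) p.225, (2.20) p.226; Balaban1985BackgroundPropagators, (3.16) p.393] -/
theorem trIP_QY_single_le (hb₁ : 0 ≤ b₁) (b₀ : FBondY i) (E : Matrix (Fin N) (Fin N) ℂ) :
    trIP i.w (QY i (parBY i) U (Pi.single b₀ E)) (QY i (parBY i) U (Pi.single b₀ E)) ≤
      2 * b₁ * ((((((PV d ℓ i.m i.K hd hL).L : ℕ) : ℝ) ^ (PV d ℓ i.m i.K hd hL).d)⁻¹) * ((((ℓ + 1 : ℕ) : ℝ)) ^ 2)⁻¹) *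
        i.cf ^ 2 * ∑ a, ∑ b, ‖E a b‖ ^ 2 := by
  rw [trIP_self_eq_sum]
  simp_rw [QY_single i hU, hs_real_smul]
  have hE := hs_nonneg E
  calc ∑ ι : IBondY i, i.w ι * ((qK i ι b₀) ^ 2 * ∑ a, ∑ b, ‖E a b‖ ^ 2)
      = (∑ ι : IBondY i, i.w ι * (qK i ι b₀) ^ 2) * ∑ a, ∑ b, ‖E a b‖ ^ 2 := by
        rw [Finset.sum_mul]; exact Finset.sum_congr rfl fun ι _ => by ring
    _ ≤ (∑ ι : IBondY i, b₁ * i.cf ^ 2 * ((((ℓ + 1 : ℕ) : ℝ)) ^ 2)⁻¹ * qK i ι b₀) * ∑ a, ∑ b, ‖E a b‖ ^ 2 :=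
        mul_le_mul_of_nonneg_right (Finset.sum_le_sum fun ι _ => w_mul_qK_sq_le i hb₁ ι b₀) hE
    _ = (b₁ * i.cf ^ 2 * ((((ℓ + 1 : ℕ) : ℝ)) ^ 2)⁻¹ * ∑ ι : IBondY i, qK i ι b₀) * ∑ a, ∑ b, ‖E a b‖ ^ 2 := by rw [← Finset.mul_sum]
    _ ≤ (b₁ * i.cf ^ 2 * ((((ℓ + 1 : ℕ) : ℝ)) ^ 2)⁻¹ * (2 * (((((PV d ℓ i.m i.K hd hL).L : ℕ) : ℝ) ^ (PV d ℓ i.m i.K hd hL).d)⁻¹))) *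
          ∑ a, ∑ b, ‖E a b‖ ^ 2 :=
        mul_le_mul_of_nonneg_right (mul_le_mul_of_nonneg_left (sum_qK_le i b₀)
          (mul_nonneg (mul_nonneg hb₁ (sq_nonneg _)) (by positivity))) hE
    _ = _ := by ring

end Averaging

end Literature.MathematicalPhysics.QuantumFieldTheory.Balaban1983to89.B9Thm311FlippedBondForms
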